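import Summits.HubbardSuperconductivity.HubbardSuperconductivity.Theorems.AnisotropyChordTransferFibre3FinX5Split
import Summits.HubbardSuperconductivity.HubbardSuperconductivity.Theorems.AnisotropyChordTransferFibre3FinX5P35q124
import Summits.HubbardSuperconductivity.HubbardSuperconductivity.Theorems.AnisotropyChordTransferFibre3FinX5P35q125

/-!
# Route `AnisotropyChord` / H0 rotor rung: FIN per-`L` GM₃ (X5), `L = 35` — row-C cell facts (X5, point wedges), part `p62`

Kernel facts `xcCellAnyA0 35 (49/50) 100 la lb bn tb = true` (row C of cert cells 144 of `L = 35` with `b = bn/100` and the `T⁺·D` brackets `tb` exported by the row-`N₁` facts `xn35_*`): the two Green point wedges `gWedgePt` are rewritten to the kernel-certified literals `gw35_*` (`…FinX5P35q*`), the profile / gradient tables are built from them by monotonicity (`…FinX5Eval`), and g5's row-C check is decided; the two row-C sums (`Ψ` and the contact-shell row sum) are certified separately as literals and substituted (`…FinX5Split`, keeps every `decide` under the kernel work ceiling); assembled in `…FinX5GM3ThirtyFive`.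
Prover seat `hubbard-h0-rotor-p3` g9; helper for piece A = stmt-HubbardSuperconductivity-23918 of rung 19089 (`--supports`, helper class).
WHAT THIS IS NOT: nothing here proves superconductivity in the Hubbard model (rotor TARGET as worded stays FALSE, g15 verdict); kernel facts for the FIN certificate of ONE conditional reduction.  Tree imports only; zero data; standard axioms.
-/

set_option linter.dupNamespace false
set_option autoImplicit false

namespace Summit.HubbardSuperconductivity.HubbardSuperconductivity.Theorems.AnisotropyChord.Transfer.Fibre3

namespace FinXD

open FinXB FinCell Hole2

set_option maxHeartbeats 4000000 in
/-- the gradient-correlation sum `Ψ` of cell 144 of `L = 35` as a literal (kernel). [folklore] -/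
theorem psi35_144_eq : xcPsi 35 (gTabA 35 1490235357620312 1527491241560820 gw35_124 gw35_125 (fTabA 35 1490235357620312 1527491241560820 gw35_124 gw35_125)) = ((1500565961031973916 : ℤ), (1737631229703432244 : ℤ)) := by decide +kernel

set_option maxHeartbeats 4000000 in
/-- the contact-shell row sum of cell 144 of `L = 35` as a literal (kernel). [folklore] -/
theorem rows35_144_eq : xcRowSum 35 (fTabA 35 1490235357620312 1527491241560820 gw35_124 gw35_125) (gTabA 35 1490235357620312 1527491241560820 gw35_124 gw35_125 (fTabA 35 1490235357620312 1527491241560820 gw35_124 gw35_125)) = ((440596352170278 : ℤ), (4759600175091967 : ℤ)) := by decide +kernel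

set_option maxHeartbeats 4000000 in
/-- row C of cell 144 of `L = 35` (`b = 164/100`). [folklore] -/
theorem xc35_144 : xcCellAnyA0 35 (49/50 : ℚ) 100 1490235357620312 1527491241560820 164 ((4523086638291183 : ℤ), (4659779065069539 : ℤ)) = true := by
  unfold xcCellAnyA0
  rw [gw35_124_eq, gw35_125_eq, ← xcCellAnyTAS_eq, psi35_144_eq, rows35_144_eq]
  decide +kernel

end FinXD

end Summit.HubbardSuperconductivity.HubbardSuperconductivity.Theorems.AnisotropyChord.Transfer.Fibre3
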